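import Literature.AlgebraicGeometry.Frobenioids.PadicKummerThm24iiOfEquivalenceAbsSq
import HarnessLib

/-!
# Frobenioids II, Theorem 2.4 (i)+(ii) for an equivalence `Ψ` of `p`-adic Frobenioids over the absolute bases `𝓑^temp(Πᵢ)⁰`
# from `Ψ` ALONE: the base 1-compatibility `(Ψ_Base, η)` supplied by [FrdI] Thm. 3.4 (v) (T24ii-J2, final knit)

Mochizuki, *The geometry of Frobenioids II*, Kyushu J. Math. **62** (2008) 401–460, §2, Theorem 2.4 pp. 19–21
[cite: MochizukiFrdII2008, Thm 2.4 (i) p.19]: "an equivalence of categories `Ψ : C₁ ⥲ C₂` — which … necessarily induces a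
1-compatible equivalence of categories `Ψ_Base : D₁ ⥲ D₂`".

PROOF-ONLY corollary (cell abc-iut, node FrdII:Thm2.4(ii), junction «T24ii-J2»; seat abc-iut-L1-d1 gen 7) of
`exists_thm24_ofEquivalenceAbs_sq` (P7): its two DATA binders `E : 𝓑^temp(Π₁)⁰ ≌ 𝓑^temp(Π₂)⁰` and
`η : Ψ ⋙ Base₂ ≅ Base₁ ⋙ E` are SUPPLIED from `Ψ` by abc-iut-L1-t7 gen 6's `PadicFrd.baseEquivalenceOf` /
`PadicFrd.baseEquivalenceIso` ([FrdI] Thm. 3.4 (v), PROVED: `FrdI.Thm34v_holds`) at the restricted equivalence `Ψ♭`, read back on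
the absolute bases through `CosetCat.relTopEquiv` (abc-iut-L1-t7 gen 7).  Result `exists_thm24_ofEquivalenceAbs_final`: the
statement of P7 with `(E, η)` turned into OUTPUT witnesses (∃) and hypotheses the printed standing ones only — `Πᵢ` temp-slim tempered (`Π₁` Galois-countable), the data
fieldwise saturated over the genuine §2 bases, `A₁`, `Ψ A₁` with Galois bases, `μ_N(K̄ᵢ) ⊆ Lᵢ`, `A₁` `(N, H₁)`-saturated, the layers
`Eᵢ`; "this isomorphism maps `H₁` onto `H₂`" stays INSIDE the statement as in print.  Nothing here bears on [IUTchIII] Cor. 3.12;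
nothing asserts abc proved or refuted.
-/

noncomputable section

namespace Literature.AlgebraicGeometry.Frobenioids

namespace PadicKummer.Def22Context

open CategoryTheory CategoryTheory.Limits Opposite Topology Filter Field IntermediateField Kummer Function
open Literature.NumberTheory.GaloisRepresentations
open Literature.NumberTheory.GaloisRepresentations.LocalWeilDatum
open Literature.NumberTheory.GaloisRepresentations.DiscreteGaloisModule
open Literature.AnabelianGeometry.SemiGraphs QuasiTemperoid PadicFrd PadicFrd.Datum PadicFrd.Datum.GaloisChart PadicFrd.RelGal
open Literature.AnabelianGeometry.AbsoluteAnabelian BaseGaloisSystem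

variable {p₁ p₂ : ℕ} [Fact p₁.Prime] [Fact p₂.Prime]
  {P₁ : Type} [Group P₁] [TopologicalSpace P₁] [IsTopologicalGroup P₁] [SecondCountableTopology P₁] (hP₁ : IsTempered P₁)
  (hZ₁ : IsSlimGroup P₁) {φ₁ : P₁ →* GalFbar ℚ_[p₁]} {hφ₁ : IsOpenHom φ₁}
  {d₁ : PadicFrd.Datum (CosetCat P₁) p₁}
  (hd₁ : d₁.base = CosetCat.push φ₁ hφ₁.isOpenMap ⋙ CosetCat.toConnected (isTempered_galFbar ℚ_[p₁]) ⋙ galoisPadicFields p₁)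
  {P₂ : Type} [Group P₂] [TopologicalSpace P₂] [IsTopologicalGroup P₂] (hP₂ : IsTempered P₂) (hZ₂ : IsSlimGroup P₂)
  {φ₂ : P₂ →* GalFbar ℚ_[p₂]} {hφ₂ : IsOpenHom φ₂}
  {d₂ : PadicFrd.Datum (CosetCat P₂) p₂}
  (hd₂ : d₂.base = CosetCat.push φ₂ hφ₂.isOpenMap ⋙ CosetCat.toConnected (isTempered_galFbar ℚ_[p₂]) ⋙ galoisPadicFields p₂)
  (hfs₁ : d₁.IsFieldwiseSaturated) (hfs₂ : d₂.IsFieldwiseSaturated)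
  (Ψ : d₁.frobenioid ≌ d₂.frobenioid)
  {A₁ : d₁.frobenioid} (hA₁ : A₁.base.sg.toSubgroup.Normal) (hA₂ : (Ψ.functor.obj A₁).base.sg.toSubgroup.Normal)
  {H₁ : Subgroup (absoluteGaloisGroup (baseFld p₁ φ₁ hφ₁))} [H₁.Normal]
  {hH₁ : IsOpen (H₁ : Set (absoluteGaloisGroup (baseFld p₁ φ₁ hφ₁)))}
  {H₂ : Subgroup (absoluteGaloisGroup (baseFld p₂ φ₂ hφ₂))} [H₂.Normal]
  {hH₂ : IsOpen (H₂ : Set (absoluteGaloisGroup (baseFld p₂ φ₂ hφ₂)))}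
  (M : ℕ) [NeZero M]
  (hμ₁ : ∀ ζ : rootsOfUnity M (AlgebraicClosure (baseFld p₁ φ₁ hφ₁)),
    ((ζ : (AlgebraicClosure (baseFld p₁ φ₁ hφ₁))ˣ) : AlgebraicClosure (baseFld p₁ φ₁ hφ₁)) ∈
      objL φ₁ hφ₁ d₁.relTop (d₁.toRelTopFrob.obj A₁))
  (hμ₂ : ∀ ζ : rootsOfUnity M (AlgebraicClosure (baseFld p₂ φ₂ hφ₂)),
    ((ζ : (AlgebraicClosure (baseFld p₂ φ₂ hφ₂))ˣ) : AlgebraicClosure (baseFld p₂ φ₂ hφ₂)) ∈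
      objL φ₂ hφ₂ d₂.relTop (d₂.toRelTopFrob.obj (Ψ.functor.obj A₁)))
  (hc₁ : IsNHSaturated (contextOfObjectAbs φ₁ hφ₁ d₁ hd₁ A₁ hA₁ H₁ hH₁) M)
  (E₁ : Type) [Field E₁] [Algebra (baseFld p₁ φ₁ hφ₁) E₁] [FiniteDimensional (baseFld p₁ φ₁ hφ₁) E₁]
  [Finite (MuCarrier E₁ M)] (hHE₁ : H₁ = galFixing (baseFld p₁ φ₁ hφ₁) (embField (baseFld p₁ φ₁ hφ₁) E₁))
  (E₂ : Type) [Field E₂] [Algebra (baseFld p₂ φ₂ hφ₂) E₂] [FiniteDimensional (baseFld p₂ φ₂ hφ₂) E₂]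
  [Finite (MuCarrier E₂ M)] (hHE₂ : H₂ = galFixing (baseFld p₂ φ₂ hφ₂) (embField (baseFld p₂ φ₂ hφ₂) E₂))

include hP₁ hZ₁ hP₂ hZ₂ hfs₁ hfs₂ in
/-- **[FrdII] Theorem 2.4 (i)+(ii) for an EQUIVALENCE `Ψ : C₁ ⥲ C₂` of `p`-adic Frobenioids over the absolute genuine bases,
from `Ψ` alone** (P7 `exists_thm24_ofEquivalenceAbs_sq` with `(E, η) := (Ψ_Base, η)` of [FrdI] Thm. 3.4 (v)): ONE representative
`β` of `G₁ ⥲ G₂` with THE [AbsAnab] units transport `ψ̄`, such that under "`G₁ ⥲ G₂` maps `H₁` onto `H₂`" the `Ψ`-induced context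
isomorphism `e` has `e.isoG = β`, is `Ψ` on `Aut_C`, satisfies `Thm24i`, and — unconditionally — `Thm24ii` for the invariants
pinned to the local-class-field-theory residue maps. [cite: MochizukiFrdII2008, Thm 2.4 (ii) p.20] -/
theorem exists_thm24_ofEquivalenceAbs_final (fs₁ fs₂ : Prop) :
    letI := PadicAlgCl.subfieldValuativeRel (baseFld p₁ φ₁ hφ₁)
    letI := PadicAlgCl.subfieldValuativeRel (baseFld p₂ φ₂ hφ₂)
    haveI := finiteDimensional_baseFld p₁ φ₁ hφ₁; haveI := finiteDimensional_baseFld p₂ φ₂ hφ₂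
    haveI := PadicAlgCl.isNonarchimedeanLocalField_subfield (baseFld p₁ φ₁ hφ₁)
    haveI := PadicAlgCl.isNonarchimedeanLocalField_subfield (baseFld p₂ φ₂ hφ₂)
    haveI := finiteDimensional_objL φ₁ hφ₁ d₁.relTop (d₁.toRelTopFrob.obj A₁)
    haveI := normal_objL φ₁ hφ₁ d₁.relTop (d₁.toRelTopFrob.obj A₁) hA₁
    haveI := finiteDimensional_objL φ₂ hφ₂ d₂.relTop (d₂.toRelTopFrob.obj (Ψ.functor.obj A₁))
    haveI := normal_objL φ₂ hφ₂ d₂.relTop (d₂.toRelTopFrob.obj (Ψ.functor.obj A₁)) hA₂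
    haveI := locallyCompactSpace_H_contextOfObjectRel φ₁ hφ₁ d₁.relTop (d₁.relTop_base_eq φ₁ hφ₁ hd₁)
      (d₁.toRelTopFrob.obj A₁) hA₁ H₁ hH₁
    haveI := locallyCompactSpace_H_contextOfObjectRel φ₂ hφ₂ d₂.relTop (d₂.relTop_base_eq φ₂ hφ₂ hd₂)
      (d₂.toRelTopFrob.obj (Ψ.functor.obj A₁)) hA₂ H₂ hH₂
    letI := (galoisChartRel φ₁ hφ₁ d₁.relTop (d₁.relTop_base_eq φ₁ hφ₁ hd₁) (d₁.toRelTopFrob.obj A₁) hA₁).galAction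
    letI := (galoisChartRel φ₂ hφ₂ d₂.relTop (d₂.relTop_base_eq φ₂ hφ₂ hd₂)
      (d₂.toRelTopFrob.obj (Ψ.functor.obj A₁)) hA₂).galAction
    letI := FiniteExtension.valuativeRel (baseFld p₁ φ₁ hφ₁) E₁
    letI := FiniteExtension.topologicalSpace (baseFld p₁ φ₁ hφ₁) E₁
    haveI := FiniteExtension.isNonarchimedeanLocalField (baseFld p₁ φ₁ hφ₁) E₁
    letI := FiniteExtension.valuativeRel (baseFld p₂ φ₂ hφ₂) E₂
    letI := FiniteExtension.topologicalSpace (baseFld p₂ φ₂ hφ₂) E₂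
    haveI := FiniteExtension.isNonarchimedeanLocalField (baseFld p₂ φ₂ hφ₂) E₂
    -- "`Ψ` necessarily induces a 1-compatible equivalence of categories `Ψ_Base`" — now an OUTPUT, no longer a binder
    ∃ (E : CosetCat P₁ ≌ CosetCat P₂)
      (_ : Ψ.functor ⋙ ModelFrobenioid.baseFunctor d₂.Φ d₂.B d₂.divB ≅ ModelFrobenioid.baseFunctor d₁.Φ d₁.B d₁.divB ⋙ E.functor)
      (β : absoluteGaloisGroup (baseFld p₁ φ₁ hφ₁) ≃ₜ* absoluteGaloisGroup (baseFld p₂ φ₂ hφ₂))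
      (ψbar : (AlgebraicClosure (baseFld p₁ φ₁ hφ₁))ˣ ≃* (AlgebraicClosure (baseFld p₂ φ₂ hφ₂))ˣ),
      Prop121vii.IsAlphaEquivariant β ψbar ∧ Prop121vii.PreservesAbsUnits ψbar ∧ Prop121vii.PreservesUniformizers ψbar ∧
      ∀ map_H : H₁.map β.toMulEquiv.toMonoidHom = H₂,
        ∃ e : (contextOfObjectAbs φ₁ hφ₁ d₁ hd₁ A₁ hA₁ H₁ hH₁).Iso
            (contextOfObjectAbs φ₂ hφ₂ d₂ hd₂ (Ψ.functor.obj A₁) hA₂ H₂ hH₂),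
          -- `e.isoG` IS `β`, and `e` on `Aut_C` IS `Ψ`
          e.isoG = β ∧
          (∀ a : Aut (d₁.toRelTopFrob.obj A₁), (e.isoC a).hom = d₂.toRelTopFrob.map (Ψ.functor.map (d₁.ofRelTopFrob.map a.hom))) ∧
          -- Theorem 2.4 (i) for `e`
          (∀ (_ : fs₁ ↔ fs₂) (eFN₁ : FN (contextOfObjectAbs φ₁ hφ₁ d₁ hd₁ A₁ hA₁ H₁ hH₁) M ≃+ ZMod M),
            Thm24i (contextOfObjectAbs φ₁ hφ₁ d₁ hd₁ A₁ hA₁ H₁ hH₁)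
              (contextOfObjectAbs φ₂ hφ₂ d₂ hd₂ (Ψ.functor.obj A₁) hA₂ H₂ hH₂) M p₁ p₂ fs₁ fs₂ (e.thm24Data M)
              ((contextOfObjectAbs φ₁ hφ₁ d₁ hd₁ A₁ hA₁ H₁ hH₁).dualityIsoOfLocalDuality M eFN₁ hc₁
                (cupDualH_bijective_ofGalois_mlf p₁ (objL φ₁ hφ₁ d₁.relTop (d₁.toRelTopFrob.obj A₁)) H₁ hH₁
                  (galoisChartRel φ₁ hφ₁ d₁.relTop (d₁.relTop_base_eq φ₁ hφ₁ hd₁) (d₁.toRelTopFrob.obj A₁) hA₁).res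
                  (galoisChartRel φ₁ hφ₁ d₁.relTop (d₁.relTop_base_eq φ₁ hφ₁ hd₁) (d₁.toRelTopFrob.obj A₁) hA₁).res_smul
                  ((galoisChartRel φ₁ hφ₁ d₁.relTop (d₁.relTop_base_eq φ₁ hφ₁ hd₁) (d₁.toRelTopFrob.obj A₁)
                    hA₁).muModel M hμ₁)))
              ((contextOfObjectAbs φ₂ hφ₂ d₂ hd₂ (Ψ.functor.obj A₁) hA₂ H₂ hH₂).dualityIsoOfLocalDuality M
                ((e.isoFN M).symm.trans eFN₁) ((e.isNHSaturated_iff M).mp hc₁)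
                (cupDualH_bijective_ofGalois_mlf p₂ (objL φ₂ hφ₂ d₂.relTop (d₂.toRelTopFrob.obj (Ψ.functor.obj A₁))) H₂ hH₂
                  (galoisChartRel φ₂ hφ₂ d₂.relTop (d₂.relTop_base_eq φ₂ hφ₂ hd₂) (d₂.toRelTopFrob.obj (Ψ.functor.obj A₁))
                    hA₂).res
                  (galoisChartRel φ₂ hφ₂ d₂.relTop (d₂.relTop_base_eq φ₂ hφ₂ hd₂) (d₂.toRelTopFrob.obj (Ψ.functor.obj A₁))
                    hA₂).res_smul
                  ((galoisChartRel φ₂ hφ₂ d₂.relTop (d₂.relTop_base_eq φ₂ hφ₂ hd₂)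
                    (d₂.toRelTopFrob.obj (Ψ.functor.obj A₁)) hA₂).muModel M hμ₂)))) ∧
          -- Theorem 2.4 (ii) for `e`
          (∃ (invE₁ : galoisCohomology (mu E₁ M) 2 →+ ZMod M) (invE₂ : galoisCohomology (mu E₂ M) 2 →+ ZMod M)
              (inv₁ : FNInvariant (contextOfObjectAbs φ₁ hφ₁ d₁ hd₁ A₁ hA₁ H₁ hH₁) M)
              (inv₂ : FNInvariant (contextOfObjectAbs φ₂ hφ₂ d₂ hd₂ (Ψ.functor.obj A₁) hA₂ H₂ hH₂) M),
              Prop121vii.IsInvariantMap E₁ M invE₁ ∧ Prop121vii.IsInvariantMap E₂ M invE₂ ∧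
              (∀ x, inv₁.toAddEquiv x = invE₁ (fnLayerMap (objL φ₁ hφ₁ d₁.relTop (d₁.toRelTopFrob.obj A₁)) H₁ hH₁
                (galoisChartRel φ₁ hφ₁ d₁.relTop (d₁.relTop_base_eq φ₁ hφ₁ hd₁) (d₁.toRelTopFrob.obj A₁) hA₁).res
                (galoisChartRel φ₁ hφ₁ d₁.relTop (d₁.relTop_base_eq φ₁ hφ₁ hd₁) (d₁.toRelTopFrob.obj A₁) hA₁).res_smul
                E₁ hHE₁ ((galoisChartRel φ₁ hφ₁ d₁.relTop (d₁.relTop_base_eq φ₁ hφ₁ hd₁) (d₁.toRelTopFrob.obj A₁)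
                  hA₁).muModel M hμ₁) x)) ∧
              (∀ x, inv₂.toAddEquiv x = invE₂ (fnLayerMap (objL φ₂ hφ₂ d₂.relTop (d₂.toRelTopFrob.obj (Ψ.functor.obj A₁)))
                H₂ hH₂
                (galoisChartRel φ₂ hφ₂ d₂.relTop (d₂.relTop_base_eq φ₂ hφ₂ hd₂) (d₂.toRelTopFrob.obj (Ψ.functor.obj A₁))
                  hA₂).res
                (galoisChartRel φ₂ hφ₂ d₂.relTop (d₂.relTop_base_eq φ₂ hφ₂ hd₂) (d₂.toRelTopFrob.obj (Ψ.functor.obj A₁))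
                  hA₂).res_smul
                E₂ hHE₂ ((galoisChartRel φ₂ hφ₂ d₂.relTop (d₂.relTop_base_eq φ₂ hφ₂ hd₂)
                  (d₂.toRelTopFrob.obj (Ψ.functor.obj A₁)) hA₂).muModel M hμ₂) x)) ∧
              Thm24ii (contextOfObjectAbs φ₁ hφ₁ d₁ hd₁ A₁ hA₁ H₁ hH₁)
                (contextOfObjectAbs φ₂ hφ₂ d₂ hd₂ (Ψ.functor.obj A₁) hA₂ H₂ hH₂) M fs₁ fs₂ (e.thm24Data M) inv₁ inv₂) := by
  -- "`Ψ` necessarily induces a 1-compatible equivalence of categories `Ψ_Base`" ([FrdI] Thm. 3.4 (v)), on the restricted data, read back on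
  -- the absolute bases through `𝓑^temp(Π)⁰ ≌ 𝓑^temp(Π, Π)⁰`
  let E : CosetCat P₁ ≌ CosetCat P₂ :=
    CosetCat.relTopEquiv.trans ((PadicFrd.baseEquivalenceOf hP₁ hZ₁ hP₂ hZ₂ (relTopEquivalence Ψ)).trans
      CosetCat.relTopEquiv.symm)
  let η : Ψ.functor ⋙ ModelFrobenioid.baseFunctor d₂.Φ d₂.B d₂.divB ≅ ModelFrobenioid.baseFunctor d₁.Φ d₁.B d₁.divB ⋙ E.functor :=
    NatIso.ofComponents
      (fun A => (RelCosetCat.incl (⊤ : OpenSubgroup P₂)).mapIso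
        ((PadicFrd.baseEquivalenceIso hP₁ hZ₁ hP₂ hZ₂ (relTopEquivalence Ψ)).app (d₁.toRelTopFrob.obj A)))
      (fun {A B} f => congrArg InducedCategory.Hom.hom
        ((PadicFrd.baseEquivalenceIso hP₁ hZ₁ hP₂ hZ₂ (relTopEquivalence Ψ)).hom.naturality (d₁.toRelTopFrob.map f)))
  exact ⟨E, η, exists_thm24_ofEquivalenceAbs_sq hP₁ hZ₁ hd₁ hP₂ hZ₂ hd₂ hfs₁ hfs₂ Ψ E η hA₁ hA₂ M hμ₁ hμ₂ hc₁ E₁ hHE₁ E₂ hHE₂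
    fs₁ fs₂⟩

end PadicKummer.Def22Context

end Literature.AlgebraicGeometry.Frobenioids

end
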